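import Summits.HodgeConjecture.CorCM.StabiliserOrbitDoubleFlipCriterion
import Summits.HodgeConjecture.CorCM.GenericCMSubfieldTowerTypes
import HarnessLib

/-!
# A DOUBLE-FLIP CM field INSIDE its partner: the tower criterion (Yanai's constant unequal multiplicities) with the even
# sign kernel only, and the quadratic step

COR-CM (cell `pub-hodgecm2`, binder seat `b16` gen 53, count-neutral claim ORBIT-CRITERION, file F7 — abstract reindexing
(§1) and CM fields / abelian varieties (§2–§3); theorems only, no definition, no named fact, no `sorry`).  NEW as stated,
hence under `Summits/`.  HONEST FRAMING: unconditional statements about pairs of CM types and products of CM abelian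
varieties; `HC_CM` is neither used nor asserted.

Gen 52 (`GenericCMSubfieldTowerPointwise`) decided a PAIR-FLIP field `K₀` inside `K₁` (`j : K₀ → K₁`) with pointwise
partial conjugations off the fibres of one `x₀` (the compositum test `y(K₁) ⊄ x₀(K₀)·y(K₁⁺)` for `y ∘ j ∉ {x₀, x̄₀}`): the
pair `(Φ₀, Φ₁)` is nondegenerate IFF `Φ₁` is nondegenerate and does NOT lie over `Φ₀` with constant unequal multiplicities
`n(x) = #{y ∈ Φ₁ : y ∘ j = x}` (Yanai, Gordon 9.4.3).  F6 (`StabiliserOrbitDoubleFlipCriterion`) runs the orbit criterion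
for DOUBLE-FLIP base fields (even sign kernel, `[K₀:ℚ] ≥ 6`; no pair flips needed).  The fibre `{y : y ∘ j = x₀}` is ONE
orbit of `Aut(ℂ / x₀K₀)` (F2 `Shadow.stab_transitive_fibre`), so:

* §1 `Shadow.card_fibre_filter_smul_eq` — orbit multiplicities of a fibre are Yanai's multiplicities at the translated
  point: `#{y : r y = x₀, g y ∈ Φ₁} = #{y ∈ Φ₁ : r y = g x₀}`; `Shadow.exists_fibreMultiplicities_iff` (the `g`-form and the
  `x`-form of «constant unequal multiplicities» agree on a transitive base).
* §2 **`isNondegenerateFamily_iff_of_doubleFlip_of_pointwiseConj`**, **`cmFamilyRank_add_card_eq_iff_of_doubleFlip_of_pointwiseConj`**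
  — `K_{i₀}` of degree `≥ 6` with DOUBLE flips, `j : K_{i₀} → K_{i₁}`, pointwise partial conjugations off the fibres of
  `x₀`: nondegenerate (resp. `Hg(A₀ × A₁) = Hg(A₀) × Hg(A₁)`) IFF `Φ₁` nondegenerate and (resp. iff) `n(x)` is NOT `a` on
  `Φ₀`, `b` off `Φ₀`, `a ≠ b`; **`isNondegenerateFamily_iff_of_doubleFlip_of_pointwiseConj_of_quadratic`** — quadratic steps
  `[K_{i₁}:ℚ] = 2[K_{i₀}:ℚ]`: nondegenerate IFF `Φ₁` is (gen 52's `not_isNondegenerate_of_multiplicities_of_quadratic`).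
  Reach: sextic fields with Galois closure `𝔖₄` of degree 24 (double flips, no pair flips) or `𝔄₄`, octic fields with
  closures of degree 32/64/96/192, inside partners of twice their degree or more.
* §3 **`hodgeConjectureFor_prod_of_doubleFlip_of_pointwiseConj`** (`_of_quadratic`), **`forall_prod_hodgeClassSpan_eq_iff_of_doubleFlip_of_pointwiseConj`**.

## References

* [Gordon1999HodgeAVSurvey] B. B. Gordon, *A survey of the Hodge conjecture for abelian varieties*, §3 Theorem, 7.5–7.7,
  9.4.3 (Yanai), 10.10.
* [Dodson1984] B. Dodson, *The structure of Galois groups of CM-fields*, Trans. AMS 283 (1984), §1.1, §5.1, §5.2.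
* [Kubota1965] T. Kubota, *On the field extension by complex multiplication*, Trans. AMS 118 (1965), §2 Lemma 2.
* [Lang2002] S. Lang, *Algebra*, GTM 211, V §2 Thm. 2.8, VI §1 Thm. 1.12.
-/

set_option autoImplicit false

noncomputable section

open scoped BigOperators

universe u

/-! ### §1 Fibre multiplicities: the `g`-form and the `x`-form -/

namespace Summit.HodgeConjecture.CorCM.Shadow

open Literature.NumberTheory.ComplexMultiplication
open scoped Classical

variable {G : Type u} [Group G] {X Y : Type*} [MulAction G X] [MulAction G Y] [Fintype Y]

/-- **Orbit multiplicities of a fibre are fibre multiplicities at the translated point**: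
`#{y : r y = x₀, g y ∈ Φ₁} = #{y : r y = g x₀, y ∈ Φ₁}` (translate by `g`). [folklore] -/
theorem card_fibre_filter_smul_eq (r : Y → X) (hr : ∀ (g : G) (y : Y), r (g • y) = g • r y) (x₀ : X) (Φ₁ : Set Y)
    (g : G) :
    (Finset.univ.filter fun y : Y => y ∈ {y : Y | r y = x₀} ∧ g • y ∈ Φ₁).card =
      (Finset.univ.filter fun y : Y => r y = g • x₀ ∧ y ∈ Φ₁).card := by
  refine Finset.card_equiv (MulAction.toPerm g) fun y => ?_
  simp only [Finset.mem_filter, Finset.mem_univ, true_and, MulAction.toPerm_apply, Set.mem_setOf_eq, hr]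
  exact ⟨fun h => ⟨by rw [h.1], h.2⟩, fun h => ⟨smul_left_cancel g h.1, h.2⟩⟩

/-- **The `g`-form and the `x`-form of «constant unequal multiplicities» agree** on a transitive base.
[cite: Gordon1999HodgeAVSurvey, 9.4.3] -/
theorem exists_fibreMultiplicities_iff [MulAction.IsPretransitive G X] (r : Y → X)
    (hr : ∀ (g : G) (y : Y), r (g • y) = g • r y) (x₀ : X) (Φ₀ : Set X) (Φ₁ : Set Y) :
    (∃ a b : ℕ, a ≠ b ∧ ∀ g : G,
        (Finset.univ.filter fun y : Y => y ∈ {y : Y | r y = x₀} ∧ g • y ∈ Φ₁).card = if g • x₀ ∈ Φ₀ then a else b) ↔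
      ∃ a b : ℕ, a ≠ b ∧ ∀ x : X,
        (Finset.univ.filter fun y : Y => r y = x ∧ y ∈ Φ₁).card = if x ∈ Φ₀ then a else b := by
  refine exists_congr fun a => exists_congr fun b => and_congr Iff.rfl ?_
  constructor
  · intro hg x
    obtain ⟨g, rfl⟩ := MulAction.exists_smul_eq G x₀ x
    exact (card_fibre_filter_smul_eq r hr x₀ Φ₁ g).symm.trans (hg g)
  · intro hx g
    exact (card_fibre_filter_smul_eq r hr x₀ Φ₁ g).trans (hx (g • x₀))

end Summit.HodgeConjecture.CorCM.Shadow

/-! ### §2 CM fields: a double-flip field inside its partner -/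

namespace Summit.HodgeConjecture.CorCM

open CategoryTheory CategoryTheory.Limits NumberField Module
open Literature.NumberTheory.ComplexMultiplication
open Literature.AlgebraicGeometry.Motives (AbelianVariety CMType)
open Literature.AlgebraicGeometry.HodgeTheory
open Literature.AlgebraicGeometry.ComplexMultiplication (IsCMTypeRealisation)
open Literature.AlgebraicGeometry.VanGeemen1994 (hodgeClassSpan)
open Literature.AlgebraicGeometry.Pohlmann1968
open Literature.Barriers.HodgeConjecture (divisorClassesSpan)
open scoped Classical

variable {I : Type} {K : I → Type} [∀ i, Field (K i)] [∀ i, NumberField (K i)] [∀ i, IsCMField (K i)] [Fintype I]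
  [DecidableEq I] {Φ : ∀ i, CMType (K i)} {i₀ i₁ : I}

section Types

omit [Fintype I] [DecidableEq I] [∀ i, NumberField (K i)] [∀ i, IsCMField (K i)] in
/-- **The fibre of `x₀` is one orbit of `Aut(ℂ / x₀K_{i₀})`** (extension of embeddings; F2's `stab_transitive_fibre`).
[cite: Lang2002, V §2 Thm. 2.8] -/
theorem stab_transitive_fibre_comp [NumberField (K i₁)] (j : K i₀ →+* K i₁) (x₀ : K i₀ →+* ℂ) :
    ∀ y ∈ {y : K i₁ →+* ℂ | y.comp j = x₀}, ∀ y' ∈ {y : K i₁ →+* ℂ | y.comp j = x₀},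
      ∃ g : ℂ ≃+* ℂ, g • x₀ = x₀ ∧ g • y = y' :=
  haveI := isPretransitive_ringEquiv_complex (K := K i₁)
  Shadow.stab_transitive_fibre (G := ℂ ≃+* ℂ) (E := fun i => K i →+* ℂ) (i₀ := i₀) (i₁ := i₁)
    (fun y : K i₁ →+* ℂ => y.comp j) (fun _ _ => rfl) x₀

omit [Fintype I] [DecidableEq I] in
/-- Off the fibres of `x₀` and `x̄₀` = off the orbit `{y : y ∘ j = x₀}` and its conjugate. [folklore] -/
theorem offFibres_of_pointwiseConj (j : K i₀ →+* K i₁) {x₀ : K i₀ →+* ℂ} (Φ₀ : CMType (K i₀))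
    (hpc : ∀ y : K i₁ →+* ℂ, y.comp j ≠ x₀ → y.comp j ≠ (starRingAut : ℂ ≃+* ℂ) • x₀ →
      ∃ σ : ℂ ≃+* ℂ, σ • x₀ = (starRingAut : ℂ ≃+* ℂ) • x₀ ∧ σ • y = y) :
    ∀ y : K i₁ →+* ℂ, y ∉ {y : K i₁ →+* ℂ | y.comp j = x₀} →
      (starRingAut : ℂ ≃+* ℂ) • y ∉ {y : K i₁ →+* ℂ | y.comp j = x₀} →
        ∃ σ : ℂ ≃+* ℂ, σ • x₀ = (starRingAut : ℂ ≃+* ℂ) • x₀ ∧ σ • y = y := by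
  intro y hy hρy
  rw [Set.mem_setOf_eq] at hy hρy
  refine hpc y hy fun h => hρy ?_
  change (starRingAut : ℂ ≃+* ℂ) • y.comp j = x₀
  rw [h, (isCMTypeWith_conj Φ₀).invol]

/-- **THE TOWER CRITERION, DOUBLE-FLIP BASE (nondegeneracy form).**  `I = {i₀, i₁}`, `K_{i₀}` of degree `≥ 6` with double
flips, `j : K_{i₀} → K_{i₁}`, pointwise partial conjugations off the fibres of `x₀`: the pair is nondegenerate IFF `Φ₁` is
nondegenerate AND `Φ₁` does NOT lie over `Φ₀` with constant unequal multiplicities `#{y ∈ Φ₁ : y ∘ j = x}`.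
[cite: Gordon1999HodgeAVSurvey, 7.5–7.7 and 9.4.3] [cite: Dodson1984, §1.1 and §5.1] -/
theorem isNondegenerateFamily_iff_of_doubleFlip_of_pointwiseConj (hI : ∀ i, i = i₀ ∨ i = i₁) (h01 : i₀ ≠ i₁)
    (h6 : 6 ≤ finrank ℚ (K i₀))
    (hflip : ∀ s t : K i₀ →+* ℂ, t ≠ s → t ≠ (starRingAut : ℂ ≃+* ℂ) • s → ∃ σ : ℂ ≃+* ℂ,
      σ • s = (starRingAut : ℂ ≃+* ℂ) • s ∧ σ • t = (starRingAut : ℂ ≃+* ℂ) • t ∧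
      ∀ u : K i₀ →+* ℂ, u ≠ s → u ≠ (starRingAut : ℂ ≃+* ℂ) • s → u ≠ t → u ≠ (starRingAut : ℂ ≃+* ℂ) • t →
        σ • u = u)
    (j : K i₀ →+* K i₁) {x₀ : K i₀ →+* ℂ}
    (hpc : ∀ y : K i₁ →+* ℂ, y.comp j ≠ x₀ → y.comp j ≠ (starRingAut : ℂ ≃+* ℂ) • x₀ →
      ∃ σ : ℂ ≃+* ℂ, σ • x₀ = (starRingAut : ℂ ≃+* ℂ) • x₀ ∧ σ • y = y) :
    CMAlgebra.IsNondegenerateFamily Φ ↔ IsNondegenerate (Φ i₁) ∧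
      ¬ ∃ a b : ℕ, a ≠ b ∧ ∀ x : K i₀ →+* ℂ,
        (Finset.univ.filter fun y : K i₁ →+* ℂ => y.comp j = x ∧ y ∈ (Φ i₁).1).card =
          if x ∈ (Φ i₀).1 then a else b := by
  haveI := isPretransitive_ringEquiv_complex (K := K i₀)
  rw [isNondegenerateFamily_iff_of_doubleFlip_of_orbit hI h01 h6 hflip {y : K i₁ →+* ℂ | y.comp j = x₀}
    (stab_transitive_fibre_comp j x₀) (offFibres_of_pointwiseConj j (Φ i₀) hpc)]
  exact and_congr Iff.rfl (not_congr (Shadow.exists_fibreMultiplicities_iff (G := ℂ ≃+* ℂ)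
    (fun y : K i₁ →+* ℂ => y.comp j) (fun _ _ => rfl) x₀ (Φ i₀).1 (Φ i₁).1))

/-- **THE TOWER CRITERION, DOUBLE-FLIP BASE (rank form)**: `rank(Φ₀, Φ₁) + 2 = rank Φ₀ + rank Φ₁ + 1`
(`Hg(A₀ × A₁) = Hg(A₀) × Hg(A₁)`) IFF `Φ₁` does not lie over `Φ₀` with constant unequal multiplicities.
[cite: Gordon1999HodgeAVSurvey, §3 Theorem (1), 7.5–7.7 and 9.4.3] [cite: Dodson1984, §1.1 and §5.1] -/
theorem cmFamilyRank_add_card_eq_iff_of_doubleFlip_of_pointwiseConj (hI : ∀ i, i = i₀ ∨ i = i₁) (h01 : i₀ ≠ i₁)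
    (h6 : 6 ≤ finrank ℚ (K i₀))
    (hflip : ∀ s t : K i₀ →+* ℂ, t ≠ s → t ≠ (starRingAut : ℂ ≃+* ℂ) • s → ∃ σ : ℂ ≃+* ℂ,
      σ • s = (starRingAut : ℂ ≃+* ℂ) • s ∧ σ • t = (starRingAut : ℂ ≃+* ℂ) • t ∧
      ∀ u : K i₀ →+* ℂ, u ≠ s → u ≠ (starRingAut : ℂ ≃+* ℂ) • s → u ≠ t → u ≠ (starRingAut : ℂ ≃+* ℂ) • t →
        σ • u = u)
    (j : K i₀ →+* K i₁) {x₀ : K i₀ →+* ℂ}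
    (hpc : ∀ y : K i₁ →+* ℂ, y.comp j ≠ x₀ → y.comp j ≠ (starRingAut : ℂ ≃+* ℂ) • x₀ →
      ∃ σ : ℂ ≃+* ℂ, σ • x₀ = (starRingAut : ℂ ≃+* ℂ) • x₀ ∧ σ • y = y) :
    CMAlgebra.cmFamilyRank Φ + Fintype.card I = (∑ i, cmTypeRank (Φ i)) + 1 ↔
      ¬ ∃ a b : ℕ, a ≠ b ∧ ∀ x : K i₀ →+* ℂ,
        (Finset.univ.filter fun y : K i₁ →+* ℂ => y.comp j = x ∧ y ∈ (Φ i₁).1).card =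
          if x ∈ (Φ i₀).1 then a else b := by
  haveI := isPretransitive_ringEquiv_complex (K := K i₀)
  rw [cmFamilyRank_add_card_eq_iff_of_doubleFlip_of_orbit hI h01 h6 hflip {y : K i₁ →+* ℂ | y.comp j = x₀}
    (stab_transitive_fibre_comp j x₀) (offFibres_of_pointwiseConj j (Φ i₀) hpc)]
  exact not_congr (Shadow.exists_fibreMultiplicities_iff (G := ℂ ≃+* ℂ) (fun y : K i₁ →+* ℂ => y.comp j)
    (fun _ _ => rfl) x₀ (Φ i₀).1 (Φ i₁).1)

/-- **QUADRATIC STEPS, DOUBLE-FLIP BASE**: `[K_{i₁} : ℚ] = 2 [K_{i₀} : ℚ]` ⟹ the pair is nondegenerate IFF `Φ₁` is — for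
EVERY pair of types (constant unequal multiplicities `(2,0)`/`(0,2)` would make `Φ₁` induced, hence degenerate).
[cite: Gordon1999HodgeAVSurvey, 7.5–7.7 and 9.4.3] [cite: Kubota1965, §2 Lemma 2] -/
theorem isNondegenerateFamily_iff_of_doubleFlip_of_pointwiseConj_of_quadratic (hI : ∀ i, i = i₀ ∨ i = i₁)
    (h01 : i₀ ≠ i₁) (h6 : 6 ≤ finrank ℚ (K i₀))
    (hflip : ∀ s t : K i₀ →+* ℂ, t ≠ s → t ≠ (starRingAut : ℂ ≃+* ℂ) • s → ∃ σ : ℂ ≃+* ℂ,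
      σ • s = (starRingAut : ℂ ≃+* ℂ) • s ∧ σ • t = (starRingAut : ℂ ≃+* ℂ) • t ∧
      ∀ u : K i₀ →+* ℂ, u ≠ s → u ≠ (starRingAut : ℂ ≃+* ℂ) • s → u ≠ t → u ≠ (starRingAut : ℂ ≃+* ℂ) • t →
        σ • u = u)
    (j : K i₀ →+* K i₁) (hdeg : finrank ℚ (K i₁) = 2 * finrank ℚ (K i₀)) {x₀ : K i₀ →+* ℂ}
    (hpc : ∀ y : K i₁ →+* ℂ, y.comp j ≠ x₀ → y.comp j ≠ (starRingAut : ℂ ≃+* ℂ) • x₀ →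
      ∃ σ : ℂ ≃+* ℂ, σ • x₀ = (starRingAut : ℂ ≃+* ℂ) • x₀ ∧ σ • y = y) :
    CMAlgebra.IsNondegenerateFamily Φ ↔ IsNondegenerate (Φ i₁) := by
  rw [isNondegenerateFamily_iff_of_doubleFlip_of_pointwiseConj hI h01 h6 hflip j hpc]
  refine ⟨fun h => h.1, fun hnd => ⟨hnd, ?_⟩⟩
  rintro ⟨a, b, hab, hmult⟩
  exact not_isNondegenerate_of_multiplicities_of_quadratic j (Φ i₁) (Φ i₀) hdeg hmult hab hnd

end Types

/-! ### §3 Abelian varieties -/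

section Varieties

variable [Nonempty I] {A : I → AbelianVariety ℂ} {ι : ∀ i, 𝓞 (K i) →+* End (A i)}
  {θ : ∀ i, K i →+* Module.End ℂ (complexBetti (A i).X 1)}

/-- **The Hodge conjecture on every `A₀^a × A₁^b`**, with `B• = D•` there, for a double-flip `K_{i₀}` of degree `≥ 6`
inside `K_{i₁}` with pointwise partial conjugations off the fibres, when `Φ₁` is nondegenerate and not of constant unequal
multiplicities over `Φ₀` — UNCONDITIONALLY. [cite: Gordon1999HodgeAVSurvey, 7.5 and 10.10] -/
theorem hodgeConjectureFor_prod_of_doubleFlip_of_pointwiseConj (hI : ∀ i, i = i₀ ∨ i = i₁) (h01 : i₀ ≠ i₁)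
    (h6 : 6 ≤ finrank ℚ (K i₀))
    (hflip : ∀ s t : K i₀ →+* ℂ, t ≠ s → t ≠ (starRingAut : ℂ ≃+* ℂ) • s → ∃ σ : ℂ ≃+* ℂ,
      σ • s = (starRingAut : ℂ ≃+* ℂ) • s ∧ σ • t = (starRingAut : ℂ ≃+* ℂ) • t ∧
      ∀ u : K i₀ →+* ℂ, u ≠ s → u ≠ (starRingAut : ℂ ≃+* ℂ) • s → u ≠ t → u ≠ (starRingAut : ℂ ≃+* ℂ) • t →
        σ • u = u)
    (j : K i₀ →+* K i₁) {x₀ : K i₀ →+* ℂ}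
    (hpc : ∀ y : K i₁ →+* ℂ, y.comp j ≠ x₀ → y.comp j ≠ (starRingAut : ℂ ≃+* ℂ) • x₀ →
      ∃ σ : ℂ ≃+* ℂ, σ • x₀ = (starRingAut : ℂ ≃+* ℂ) • x₀ ∧ σ • y = y)
    (hnd : IsNondegenerate (Φ i₁))
    (hnot : ¬ ∃ a b : ℕ, a ≠ b ∧ ∀ x : K i₀ →+* ℂ,
      (Finset.univ.filter fun y : K i₁ →+* ℂ => y.comp j = x ∧ y ∈ (Φ i₁).1).card = if x ∈ (Φ i₀).1 then a else b)
    (hA : ∀ i, IsCMTypeRealisation (Φ i) (A i) (ι i) (θ i)) {N : ℕ} (π : Fin N → I) :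
    HodgeConjectureFor (⨁ fun j : Fin N => A (π j)).dim (⨁ fun j : Fin N => A (π j)).X ∧
      ∀ m : ℕ, hodgeClassSpan (⨁ fun j : Fin N => A (π j)).dim (⨁ fun j : Fin N => A (π j)).X m =
        divisorClassesSpan (⨁ fun j : Fin N => A (π j)).X (⨁ fun j : Fin N => A (π j)).dim m :=
  have h := (isNondegenerateFamily_iff_of_doubleFlip_of_pointwiseConj hI h01 h6 hflip j hpc).2 ⟨hnd, hnot⟩
  ⟨h.hodgeConjectureFor_prod hA π, fun m => h.hodgeClassSpan_prod_eq_divisorClassesSpan hA π m⟩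

/-- **Quadratic steps on abelian varieties, double-flip base**: `[K_{i₁}:ℚ] = 2[K_{i₀}:ℚ]`, `Φ₁` nondegenerate ⟹ the Hodge
conjecture with `B• = D•` on every `A₀^a × A₁^b`, UNCONDITIONALLY. [cite: Gordon1999HodgeAVSurvey, 7.5 and 10.10]
[cite: Kubota1965, §2 Lemma 2] -/
theorem hodgeConjectureFor_prod_of_doubleFlip_of_pointwiseConj_of_quadratic (hI : ∀ i, i = i₀ ∨ i = i₁)
    (h01 : i₀ ≠ i₁) (h6 : 6 ≤ finrank ℚ (K i₀))
    (hflip : ∀ s t : K i₀ →+* ℂ, t ≠ s → t ≠ (starRingAut : ℂ ≃+* ℂ) • s → ∃ σ : ℂ ≃+* ℂ,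
      σ • s = (starRingAut : ℂ ≃+* ℂ) • s ∧ σ • t = (starRingAut : ℂ ≃+* ℂ) • t ∧
      ∀ u : K i₀ →+* ℂ, u ≠ s → u ≠ (starRingAut : ℂ ≃+* ℂ) • s → u ≠ t → u ≠ (starRingAut : ℂ ≃+* ℂ) • t →
        σ • u = u)
    (j : K i₀ →+* K i₁) (hdeg : finrank ℚ (K i₁) = 2 * finrank ℚ (K i₀)) {x₀ : K i₀ →+* ℂ}
    (hpc : ∀ y : K i₁ →+* ℂ, y.comp j ≠ x₀ → y.comp j ≠ (starRingAut : ℂ ≃+* ℂ) • x₀ →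
      ∃ σ : ℂ ≃+* ℂ, σ • x₀ = (starRingAut : ℂ ≃+* ℂ) • x₀ ∧ σ • y = y)
    (hnd : IsNondegenerate (Φ i₁)) (hA : ∀ i, IsCMTypeRealisation (Φ i) (A i) (ι i) (θ i)) {N : ℕ}
    (π : Fin N → I) :
    HodgeConjectureFor (⨁ fun j : Fin N => A (π j)).dim (⨁ fun j : Fin N => A (π j)).X ∧
      ∀ m : ℕ, hodgeClassSpan (⨁ fun j : Fin N => A (π j)).dim (⨁ fun j : Fin N => A (π j)).X m =
        divisorClassesSpan (⨁ fun j : Fin N => A (π j)).X (⨁ fun j : Fin N => A (π j)).dim m :=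
  have h := (isNondegenerateFamily_iff_of_doubleFlip_of_pointwiseConj_of_quadratic hI h01 h6 hflip j hdeg hpc).2 hnd
  ⟨h.hodgeConjectureFor_prod hA π, fun m => h.hodgeClassSpan_prod_eq_divisorClassesSpan hA π m⟩

/-- **SIMPLE, NON-ISOGENOUS realisations, double-flip base inside its partner: `B• = D•` on ALL products `A₀^a × A₁^b` IFF
`Φ₁` is nondegenerate and not of constant unequal multiplicities over `Φ₀`**; otherwise some product carries an exceptional
Hodge class. [cite: Gordon1999HodgeAVSurvey, 7.5 and 7.6.1] -/
theorem forall_prod_hodgeClassSpan_eq_iff_of_doubleFlip_of_pointwiseConj (hI : ∀ i, i = i₀ ∨ i = i₁) (h01 : i₀ ≠ i₁)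
    (h6 : 6 ≤ finrank ℚ (K i₀))
    (hflip : ∀ s t : K i₀ →+* ℂ, t ≠ s → t ≠ (starRingAut : ℂ ≃+* ℂ) • s → ∃ σ : ℂ ≃+* ℂ,
      σ • s = (starRingAut : ℂ ≃+* ℂ) • s ∧ σ • t = (starRingAut : ℂ ≃+* ℂ) • t ∧
      ∀ u : K i₀ →+* ℂ, u ≠ s → u ≠ (starRingAut : ℂ ≃+* ℂ) • s → u ≠ t → u ≠ (starRingAut : ℂ ≃+* ℂ) • t →
        σ • u = u)
    (j : K i₀ →+* K i₁) {x₀ : K i₀ →+* ℂ}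
    (hpc : ∀ y : K i₁ →+* ℂ, y.comp j ≠ x₀ → y.comp j ≠ (starRingAut : ℂ ≃+* ℂ) • x₀ →
      ∃ σ : ℂ ≃+* ℂ, σ • x₀ = (starRingAut : ℂ ≃+* ℂ) • x₀ ∧ σ • y = y)
    (hA : ∀ i, IsCMTypeRealisation (Φ i) (A i) (ι i) (θ i)) (hs : ∀ i, (A i).IsSimple)
    (hniso : ∀ i i', i ≠ i' → ¬ AbelianVariety.IsIsogenous (A i) (A i')) :
    (∀ (N : ℕ) (π : Fin N → I) (m : ℕ),
      hodgeClassSpan (⨁ fun j : Fin N => A (π j)).dim (⨁ fun j : Fin N => A (π j)).X m =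
        divisorClassesSpan (⨁ fun j : Fin N => A (π j)).X (⨁ fun j : Fin N => A (π j)).dim m) ↔
      IsNondegenerate (Φ i₁) ∧ ¬ ∃ a b : ℕ, a ≠ b ∧ ∀ x : K i₀ →+* ℂ,
        (Finset.univ.filter fun y : K i₁ →+* ℂ => y.comp j = x ∧ y ∈ (Φ i₁).1).card =
          if x ∈ (Φ i₀).1 then a else b := by
  rw [← CMAlgebra.isNondegenerateFamily_iff_forall_prod_hodgeClassSpan_eq
    (CMAlgebra.isSeparatingFamily_of_isSimple_of_pairwise_not_isIsogenous hA hs hniso) hA]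
  exact isNondegenerateFamily_iff_of_doubleFlip_of_pointwiseConj hI h01 h6 hflip j hpc

end Varieties

end Summit.HodgeConjecture.CorCM

end
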